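import Mathlib
import Summits.KontsevichZagierPeriods.Zeta5Search.Families.DualSpanProdCoeff
import Literature.RingTheory.MvPolynomial.WeightOperators
import HarnessLib

/-!
# ζ(5) search — Families: the DILATION relations `D₁…D₄` of the dual span product (completing `D₀ = T₀`, `D₅ = T₆`)

HONEST FRAMING: systematic search; no irrationality claim unless certified.  Cell `pub-zeta5`, certifier 2
(cert-2 g7, 2026-08-21).  Identities between integers (coefficients of integer polynomials); no conjecture node;
nothing about `ζ(5)`; no number of record moves.

Companion of `Families/DualConstantTermTranslations` (p308532).  The Euler operator `θ_w = g_w∂_w` ("dilation of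
the gap `g_w`") applied to P2 g6's dual span product gives, via Leibniz (`pderiv_dil1…4`) and the coefficient
identity `[m](X_w∂_wF) = m_w[m]F` (`Literature.RingTheory.MvPolynomial.coeff_X_mul_pderiv`), the relations
  `D_w : (B_w+1)·[g^{B+e_w}]N_A = Σ_{e ∋ g_w} A_e·[g^B]N_{A−e}`     (`coeff_dil1 … coeff_dil4`; all `A`, `B`;
  `D₀ = DualCT.coeff_transl0`, `D₅ = DualCT.coeff_transl6`).
These are the primitive torus-Stokes relations: a θ-certificate `C_w = Σ c·∏L^ν∏g^{−m}` for a STAR/PENCIL relation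
of gen-1 (found by `HOME/cert-2/g7/dexact/starcert2.py`, read off by `sol16.py`; list in `DEXACT-PLAN.md` §6) is,
term by term, `c·D_w` at the shifted exponent `(A+ν, B+m)`; the span inclusions then identify the terms
(`Families/DualConstantTermStar46`, `…Star16`).
-/

noncomputable section
open MvPolynomial Finset
open Literature.RingTheory.MvPolynomial (coeff_X_mul_pderiv)

namespace Summit.KontsevichZagierPeriods.Zeta5Search.Families.Cellular
namespace DualCT

/-- Dilation of the gap `g1`: `∂1(dualSpanProd A)` in terms of the span products with one exponent lowered
(the spans containing `g1`: exponents A0, A1, A6, A7). -/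
theorem pderiv_dil1 (A : Fin 8 → ℕ) :
    pderiv 1 (dualSpanProd A) =
      ((A 0 : ℕ) : P6) * dualSpanProd (Function.update A 0 (A 0 - 1))
        + ((A 1 : ℕ) : P6) * dualSpanProd (Function.update A 1 (A 1 - 1))
        + ((A 6 : ℕ) : P6) * dualSpanProd (Function.update A 6 (A 6 - 1))
        + ((A 7 : ℕ) : P6) * dualSpanProd (Function.update A 7 (A 7 - 1)) := by
  unfold dualSpanProd
  simp only [Function.update_self, Function.update_of_ne (by decide : (1 : Fin 8) ≠ 0),
    Function.update_of_ne (by decide : (2 : Fin 8) ≠ 0), Function.update_of_ne (by decide : (3 : Fin 8) ≠ 0),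
    Function.update_of_ne (by decide : (6 : Fin 8) ≠ 0), Function.update_of_ne (by decide : (7 : Fin 8) ≠ 0),
    Function.update_of_ne (by decide : (0 : Fin 8) ≠ 1), Function.update_of_ne (by decide : (2 : Fin 8) ≠ 1),
    Function.update_of_ne (by decide : (3 : Fin 8) ≠ 1), Function.update_of_ne (by decide : (6 : Fin 8) ≠ 1),
    Function.update_of_ne (by decide : (7 : Fin 8) ≠ 1), Function.update_of_ne (by decide : (0 : Fin 8) ≠ 6),
    Function.update_of_ne (by decide : (1 : Fin 8) ≠ 6), Function.update_of_ne (by decide : (2 : Fin 8) ≠ 6),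
    Function.update_of_ne (by decide : (3 : Fin 8) ≠ 6), Function.update_of_ne (by decide : (7 : Fin 8) ≠ 6),
    Function.update_of_ne (by decide : (0 : Fin 8) ≠ 7), Function.update_of_ne (by decide : (1 : Fin 8) ≠ 7),
    Function.update_of_ne (by decide : (2 : Fin 8) ≠ 7), Function.update_of_ne (by decide : (3 : Fin 8) ≠ 7),
    Function.update_of_ne (by decide : (6 : Fin 8) ≠ 7), pderiv_mul, pderiv_pow, map_add, pderiv_X_self,
    pderiv_X_of_ne (show (0 : Fin 6) ≠ 1 by decide), pderiv_X_of_ne (show (2 : Fin 6) ≠ 1 by decide),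
    pderiv_X_of_ne (show (3 : Fin 6) ≠ 1 by decide), pderiv_X_of_ne (show (4 : Fin 6) ≠ 1 by decide),
    pderiv_X_of_ne (show (5 : Fin 6) ≠ 1 by decide)]
  ring

/-- **Dilation relation D1**: `(B1+1)·[g^(B+e1)]N_A = Σ_(e ∋ g1) A_e·[g^B]N_(A−e)` (all `A`, `B`). -/
theorem coeff_dil1 (A : Fin 8 → ℕ) (B : Fin 6 →₀ ℕ) :
    ((B 1 : ℤ) + 1) * coeff (B + Finsupp.single 1 1) (dualSpanProd A) =
      (A 0 : ℤ) * coeff B (dualSpanProd (Function.update A 0 (A 0 - 1)))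
        + (A 1 : ℤ) * coeff B (dualSpanProd (Function.update A 1 (A 1 - 1)))
        + (A 6 : ℤ) * coeff B (dualSpanProd (Function.update A 6 (A 6 - 1)))
        + (A 7 : ℤ) * coeff B (dualSpanProd (Function.update A 7 (A 7 - 1))) := by
  set N := dualSpanProd A with hN
  have hD := pderiv_dil1 A
  have key : X 1 * pderiv 1 N =
      C ((A 0 : ℕ) : ℤ) * (X 1 * dualSpanProd (Function.update A 0 (A 0 - 1)))
        + C ((A 1 : ℕ) : ℤ) * (X 1 * dualSpanProd (Function.update A 1 (A 1 - 1)))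
        + C ((A 6 : ℕ) : ℤ) * (X 1 * dualSpanProd (Function.update A 6 (A 6 - 1)))
        + C ((A 7 : ℕ) : ℤ) * (X 1 * dualSpanProd (Function.update A 7 (A 7 - 1))) := by
    simp only [map_natCast]
    linear_combination (X 1 : P6) * hD
  have hw : (1 : Fin 6) ∈ (B + Finsupp.single 1 1).support := by simp
  have ew : B + Finsupp.single 1 1 - Finsupp.single 1 1 = B := add_tsub_cancel_right _ _
  have cw : ((B + Finsupp.single 1 1 : Fin 6 →₀ ℕ) 1 : ℕ) = B 1 + 1 := by simp
  have hk := congrArg (coeff (B + Finsupp.single 1 1)) key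
  simp only [coeff_add, coeff_C_mul] at hk
  rw [coeff_X_mul_pderiv, cw, coeff_X_mul', if_pos hw, ew, coeff_X_mul', if_pos hw, ew, coeff_X_mul', if_pos hw,
    ew, coeff_X_mul', if_pos hw, ew] at hk
  push_cast at hk ⊢
  linear_combination hk

/-- Dilation of the gap `g2`: `∂2(dualSpanProd A)` in terms of the span products with one exponent lowered
(the spans containing `g2`: exponents A0, A1, A2, A3, A6, A7). -/
theorem pderiv_dil2 (A : Fin 8 → ℕ) :
    pderiv 2 (dualSpanProd A) =
      ((A 0 : ℕ) : P6) * dualSpanProd (Function.update A 0 (A 0 - 1))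
        + ((A 1 : ℕ) : P6) * dualSpanProd (Function.update A 1 (A 1 - 1))
        + ((A 2 : ℕ) : P6) * dualSpanProd (Function.update A 2 (A 2 - 1))
        + ((A 3 : ℕ) : P6) * dualSpanProd (Function.update A 3 (A 3 - 1))
        + ((A 6 : ℕ) : P6) * dualSpanProd (Function.update A 6 (A 6 - 1))
        + ((A 7 : ℕ) : P6) * dualSpanProd (Function.update A 7 (A 7 - 1)) := by
  unfold dualSpanProd
  simp only [Function.update_self, Function.update_of_ne (by decide : (1 : Fin 8) ≠ 0),
    Function.update_of_ne (by decide : (2 : Fin 8) ≠ 0), Function.update_of_ne (by decide : (3 : Fin 8) ≠ 0),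
    Function.update_of_ne (by decide : (6 : Fin 8) ≠ 0), Function.update_of_ne (by decide : (7 : Fin 8) ≠ 0),
    Function.update_of_ne (by decide : (0 : Fin 8) ≠ 1), Function.update_of_ne (by decide : (2 : Fin 8) ≠ 1),
    Function.update_of_ne (by decide : (3 : Fin 8) ≠ 1), Function.update_of_ne (by decide : (6 : Fin 8) ≠ 1),
    Function.update_of_ne (by decide : (7 : Fin 8) ≠ 1), Function.update_of_ne (by decide : (0 : Fin 8) ≠ 2),
    Function.update_of_ne (by decide : (1 : Fin 8) ≠ 2), Function.update_of_ne (by decide : (3 : Fin 8) ≠ 2),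
    Function.update_of_ne (by decide : (6 : Fin 8) ≠ 2), Function.update_of_ne (by decide : (7 : Fin 8) ≠ 2),
    Function.update_of_ne (by decide : (0 : Fin 8) ≠ 3), Function.update_of_ne (by decide : (1 : Fin 8) ≠ 3),
    Function.update_of_ne (by decide : (2 : Fin 8) ≠ 3), Function.update_of_ne (by decide : (6 : Fin 8) ≠ 3),
    Function.update_of_ne (by decide : (7 : Fin 8) ≠ 3), Function.update_of_ne (by decide : (0 : Fin 8) ≠ 6),
    Function.update_of_ne (by decide : (1 : Fin 8) ≠ 6), Function.update_of_ne (by decide : (2 : Fin 8) ≠ 6),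
    Function.update_of_ne (by decide : (3 : Fin 8) ≠ 6), Function.update_of_ne (by decide : (7 : Fin 8) ≠ 6),
    Function.update_of_ne (by decide : (0 : Fin 8) ≠ 7), Function.update_of_ne (by decide : (1 : Fin 8) ≠ 7),
    Function.update_of_ne (by decide : (2 : Fin 8) ≠ 7), Function.update_of_ne (by decide : (3 : Fin 8) ≠ 7),
    Function.update_of_ne (by decide : (6 : Fin 8) ≠ 7), pderiv_mul, pderiv_pow, map_add, pderiv_X_self,
    pderiv_X_of_ne (show (0 : Fin 6) ≠ 2 by decide), pderiv_X_of_ne (show (1 : Fin 6) ≠ 2 by decide),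
    pderiv_X_of_ne (show (3 : Fin 6) ≠ 2 by decide), pderiv_X_of_ne (show (4 : Fin 6) ≠ 2 by decide),
    pderiv_X_of_ne (show (5 : Fin 6) ≠ 2 by decide)]
  ring

/-- **Dilation relation D2**: `(B2+1)·[g^(B+e2)]N_A = Σ_(e ∋ g2) A_e·[g^B]N_(A−e)` (all `A`, `B`). -/
theorem coeff_dil2 (A : Fin 8 → ℕ) (B : Fin 6 →₀ ℕ) :
    ((B 2 : ℤ) + 1) * coeff (B + Finsupp.single 2 1) (dualSpanProd A) =
      (A 0 : ℤ) * coeff B (dualSpanProd (Function.update A 0 (A 0 - 1)))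
        + (A 1 : ℤ) * coeff B (dualSpanProd (Function.update A 1 (A 1 - 1)))
        + (A 2 : ℤ) * coeff B (dualSpanProd (Function.update A 2 (A 2 - 1)))
        + (A 3 : ℤ) * coeff B (dualSpanProd (Function.update A 3 (A 3 - 1)))
        + (A 6 : ℤ) * coeff B (dualSpanProd (Function.update A 6 (A 6 - 1)))
        + (A 7 : ℤ) * coeff B (dualSpanProd (Function.update A 7 (A 7 - 1))) := by
  set N := dualSpanProd A with hN
  have hD := pderiv_dil2 A
  have key : X 2 * pderiv 2 N =
      C ((A 0 : ℕ) : ℤ) * (X 2 * dualSpanProd (Function.update A 0 (A 0 - 1)))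
        + C ((A 1 : ℕ) : ℤ) * (X 2 * dualSpanProd (Function.update A 1 (A 1 - 1)))
        + C ((A 2 : ℕ) : ℤ) * (X 2 * dualSpanProd (Function.update A 2 (A 2 - 1)))
        + C ((A 3 : ℕ) : ℤ) * (X 2 * dualSpanProd (Function.update A 3 (A 3 - 1)))
        + C ((A 6 : ℕ) : ℤ) * (X 2 * dualSpanProd (Function.update A 6 (A 6 - 1)))
        + C ((A 7 : ℕ) : ℤ) * (X 2 * dualSpanProd (Function.update A 7 (A 7 - 1))) := by
    simp only [map_natCast]
    linear_combination (X 2 : P6) * hD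
  have hw : (2 : Fin 6) ∈ (B + Finsupp.single 2 1).support := by simp
  have ew : B + Finsupp.single 2 1 - Finsupp.single 2 1 = B := add_tsub_cancel_right _ _
  have cw : ((B + Finsupp.single 2 1 : Fin 6 →₀ ℕ) 2 : ℕ) = B 2 + 1 := by simp
  have hk := congrArg (coeff (B + Finsupp.single 2 1)) key
  simp only [coeff_add, coeff_C_mul] at hk
  rw [coeff_X_mul_pderiv, cw, coeff_X_mul', if_pos hw, ew, coeff_X_mul', if_pos hw, ew, coeff_X_mul', if_pos hw,
    ew, coeff_X_mul', if_pos hw, ew, coeff_X_mul', if_pos hw, ew, coeff_X_mul', if_pos hw, ew] at hk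
  push_cast at hk ⊢
  linear_combination hk

/-- Dilation of the gap `g3`: `∂3(dualSpanProd A)` in terms of the span products with one exponent lowered
(the spans containing `g3`: exponents A1, A2, A3, A6). -/
theorem pderiv_dil3 (A : Fin 8 → ℕ) :
    pderiv 3 (dualSpanProd A) =
      ((A 1 : ℕ) : P6) * dualSpanProd (Function.update A 1 (A 1 - 1))
        + ((A 2 : ℕ) : P6) * dualSpanProd (Function.update A 2 (A 2 - 1))
        + ((A 3 : ℕ) : P6) * dualSpanProd (Function.update A 3 (A 3 - 1))
        + ((A 6 : ℕ) : P6) * dualSpanProd (Function.update A 6 (A 6 - 1)) := by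
  unfold dualSpanProd
  simp only [Function.update_self, Function.update_of_ne (by decide : (0 : Fin 8) ≠ 1),
    Function.update_of_ne (by decide : (2 : Fin 8) ≠ 1), Function.update_of_ne (by decide : (3 : Fin 8) ≠ 1),
    Function.update_of_ne (by decide : (6 : Fin 8) ≠ 1), Function.update_of_ne (by decide : (7 : Fin 8) ≠ 1),
    Function.update_of_ne (by decide : (0 : Fin 8) ≠ 2), Function.update_of_ne (by decide : (1 : Fin 8) ≠ 2),
    Function.update_of_ne (by decide : (3 : Fin 8) ≠ 2), Function.update_of_ne (by decide : (6 : Fin 8) ≠ 2),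
    Function.update_of_ne (by decide : (7 : Fin 8) ≠ 2), Function.update_of_ne (by decide : (0 : Fin 8) ≠ 3),
    Function.update_of_ne (by decide : (1 : Fin 8) ≠ 3), Function.update_of_ne (by decide : (2 : Fin 8) ≠ 3),
    Function.update_of_ne (by decide : (6 : Fin 8) ≠ 3), Function.update_of_ne (by decide : (7 : Fin 8) ≠ 3),
    Function.update_of_ne (by decide : (0 : Fin 8) ≠ 6), Function.update_of_ne (by decide : (1 : Fin 8) ≠ 6),
    Function.update_of_ne (by decide : (2 : Fin 8) ≠ 6), Function.update_of_ne (by decide : (3 : Fin 8) ≠ 6),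
    Function.update_of_ne (by decide : (7 : Fin 8) ≠ 6), pderiv_mul, pderiv_pow, map_add, pderiv_X_self,
    pderiv_X_of_ne (show (0 : Fin 6) ≠ 3 by decide), pderiv_X_of_ne (show (1 : Fin 6) ≠ 3 by decide),
    pderiv_X_of_ne (show (2 : Fin 6) ≠ 3 by decide), pderiv_X_of_ne (show (4 : Fin 6) ≠ 3 by decide),
    pderiv_X_of_ne (show (5 : Fin 6) ≠ 3 by decide)]
  ring

/-- **Dilation relation D3**: `(B3+1)·[g^(B+e3)]N_A = Σ_(e ∋ g3) A_e·[g^B]N_(A−e)` (all `A`, `B`). -/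
theorem coeff_dil3 (A : Fin 8 → ℕ) (B : Fin 6 →₀ ℕ) :
    ((B 3 : ℤ) + 1) * coeff (B + Finsupp.single 3 1) (dualSpanProd A) =
      (A 1 : ℤ) * coeff B (dualSpanProd (Function.update A 1 (A 1 - 1)))
        + (A 2 : ℤ) * coeff B (dualSpanProd (Function.update A 2 (A 2 - 1)))
        + (A 3 : ℤ) * coeff B (dualSpanProd (Function.update A 3 (A 3 - 1)))
        + (A 6 : ℤ) * coeff B (dualSpanProd (Function.update A 6 (A 6 - 1))) := by
  set N := dualSpanProd A with hN
  have hD := pderiv_dil3 A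
  have key : X 3 * pderiv 3 N =
      C ((A 1 : ℕ) : ℤ) * (X 3 * dualSpanProd (Function.update A 1 (A 1 - 1)))
        + C ((A 2 : ℕ) : ℤ) * (X 3 * dualSpanProd (Function.update A 2 (A 2 - 1)))
        + C ((A 3 : ℕ) : ℤ) * (X 3 * dualSpanProd (Function.update A 3 (A 3 - 1)))
        + C ((A 6 : ℕ) : ℤ) * (X 3 * dualSpanProd (Function.update A 6 (A 6 - 1))) := by
    simp only [map_natCast]
    linear_combination (X 3 : P6) * hD
  have hw : (3 : Fin 6) ∈ (B + Finsupp.single 3 1).support := by simp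
  have ew : B + Finsupp.single 3 1 - Finsupp.single 3 1 = B := add_tsub_cancel_right _ _
  have cw : ((B + Finsupp.single 3 1 : Fin 6 →₀ ℕ) 3 : ℕ) = B 3 + 1 := by simp
  have hk := congrArg (coeff (B + Finsupp.single 3 1)) key
  simp only [coeff_add, coeff_C_mul] at hk
  rw [coeff_X_mul_pderiv, cw, coeff_X_mul', if_pos hw, ew, coeff_X_mul', if_pos hw, ew, coeff_X_mul', if_pos hw,
    ew, coeff_X_mul', if_pos hw, ew] at hk
  push_cast at hk ⊢
  linear_combination hk

/-- Dilation of the gap `g4`: `∂4(dualSpanProd A)` in terms of the span products with one exponent lowered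
(the spans containing `g4`: exponents A1, A2, A3). -/
theorem pderiv_dil4 (A : Fin 8 → ℕ) :
    pderiv 4 (dualSpanProd A) =
      ((A 1 : ℕ) : P6) * dualSpanProd (Function.update A 1 (A 1 - 1))
        + ((A 2 : ℕ) : P6) * dualSpanProd (Function.update A 2 (A 2 - 1))
        + ((A 3 : ℕ) : P6) * dualSpanProd (Function.update A 3 (A 3 - 1)) := by
  unfold dualSpanProd
  simp only [Function.update_self, Function.update_of_ne (by decide : (0 : Fin 8) ≠ 1),
    Function.update_of_ne (by decide : (2 : Fin 8) ≠ 1), Function.update_of_ne (by decide : (3 : Fin 8) ≠ 1),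
    Function.update_of_ne (by decide : (6 : Fin 8) ≠ 1), Function.update_of_ne (by decide : (7 : Fin 8) ≠ 1),
    Function.update_of_ne (by decide : (0 : Fin 8) ≠ 2), Function.update_of_ne (by decide : (1 : Fin 8) ≠ 2),
    Function.update_of_ne (by decide : (3 : Fin 8) ≠ 2), Function.update_of_ne (by decide : (6 : Fin 8) ≠ 2),
    Function.update_of_ne (by decide : (7 : Fin 8) ≠ 2), Function.update_of_ne (by decide : (0 : Fin 8) ≠ 3),
    Function.update_of_ne (by decide : (1 : Fin 8) ≠ 3), Function.update_of_ne (by decide : (2 : Fin 8) ≠ 3),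
    Function.update_of_ne (by decide : (6 : Fin 8) ≠ 3), Function.update_of_ne (by decide : (7 : Fin 8) ≠ 3),
    pderiv_mul, pderiv_pow, map_add, pderiv_X_self, pderiv_X_of_ne (show (0 : Fin 6) ≠ 4 by decide),
    pderiv_X_of_ne (show (1 : Fin 6) ≠ 4 by decide), pderiv_X_of_ne (show (2 : Fin 6) ≠ 4 by decide),
    pderiv_X_of_ne (show (3 : Fin 6) ≠ 4 by decide), pderiv_X_of_ne (show (5 : Fin 6) ≠ 4 by decide)]
  ring

/-- **Dilation relation D4**: `(B4+1)·[g^(B+e4)]N_A = Σ_(e ∋ g4) A_e·[g^B]N_(A−e)` (all `A`, `B`). -/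
theorem coeff_dil4 (A : Fin 8 → ℕ) (B : Fin 6 →₀ ℕ) :
    ((B 4 : ℤ) + 1) * coeff (B + Finsupp.single 4 1) (dualSpanProd A) =
      (A 1 : ℤ) * coeff B (dualSpanProd (Function.update A 1 (A 1 - 1)))
        + (A 2 : ℤ) * coeff B (dualSpanProd (Function.update A 2 (A 2 - 1)))
        + (A 3 : ℤ) * coeff B (dualSpanProd (Function.update A 3 (A 3 - 1))) := by
  set N := dualSpanProd A with hN
  have hD := pderiv_dil4 A
  have key : X 4 * pderiv 4 N =
      C ((A 1 : ℕ) : ℤ) * (X 4 * dualSpanProd (Function.update A 1 (A 1 - 1)))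
        + C ((A 2 : ℕ) : ℤ) * (X 4 * dualSpanProd (Function.update A 2 (A 2 - 1)))
        + C ((A 3 : ℕ) : ℤ) * (X 4 * dualSpanProd (Function.update A 3 (A 3 - 1))) := by
    simp only [map_natCast]
    linear_combination (X 4 : P6) * hD
  have hw : (4 : Fin 6) ∈ (B + Finsupp.single 4 1).support := by simp
  have ew : B + Finsupp.single 4 1 - Finsupp.single 4 1 = B := add_tsub_cancel_right _ _
  have cw : ((B + Finsupp.single 4 1 : Fin 6 →₀ ℕ) 4 : ℕ) = B 4 + 1 := by simp
  have hk := congrArg (coeff (B + Finsupp.single 4 1)) key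
  simp only [coeff_add, coeff_C_mul] at hk
  rw [coeff_X_mul_pderiv, cw, coeff_X_mul', if_pos hw, ew, coeff_X_mul', if_pos hw, ew, coeff_X_mul', if_pos hw,
    ew] at hk
  push_cast at hk ⊢
  linear_combination hk

end DualCT
end Summit.KontsevichZagierPeriods.Zeta5Search.Families.Cellular
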